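import Mathlib
import HarnessLib

/-!
# Route `SqueezedSkewness`, crux `ShellSign` (stmt-QuantumFields-27861): the HYPEROCTAHEDRAL CHANNEL SELECTION (layer-2 lemma,
# representation theory of `B₄`, hypothesis-free)

The route's thesis (Theses/SqueezedSkewness.lean, «NOT DECOMPOSED YET. Inside ShellSign: the B₄ channel selection (representation
theory, provable now …) … are layer-2 lemmas for provers (--supports ShellSign)») and the birth skeleton
`Cruxes/NT/Lines/squeezed_skewness_birth.lean` («`B₄` has no invariant vector in `Sym²₀(ℝ⁴)` nor in the Weyl module `(2,0)⊕(0,2)`, so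
the shell average kills the spin-2 and (anti)self-dual dimension-4 channels of the lattice OPE `dens × dens`; `F·F̃` drops by parity»)
ask for the following finite-group fact, used when the `B₄`-symmetric shell `h` (`h(e₀ + Tu) = h(e₀ + u)` for every signed coordinate
permutation `T`) is summed against `B₄`-covariant fusion coefficients: the shell-summed coefficient tensor is `B₄`-INVARIANT, and

* `rank_two_eq_of_hyperoctahedral` — a rank-2 tensor `K_{μν}` on `ℝ⁴` invariant under all coordinate sign flips and all coordinate
  permutations is `K_{00}·δ_{μν}`; hence (`rank_two_eq_zero_of_traceless`) a TRACELESS invariant rank-2 tensor vanishes — no `B₄`-invariant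
  vector in `Sym²₀(ℝ⁴)` (the spin-2 channel `F_{μρ}F_{νρ} − ¼δ_{μν}F²` dies);
* `rank_four_eq_of_hyperoctahedral` — a curvature-type rank-4 tensor `K_{μνρσ}` (antisymmetric in `μν` and in `ρσ`) invariant under all
  sign flips and permutations is `K_{0101}·(δ_{μρ}δ_{νσ} − δ_{μσ}δ_{νρ})`: the `B₄`-invariants of `Λ²ℝ⁴ ⊗ Λ²ℝ⁴` are ONE-dimensional, spanned
  by the identity of `Λ²` — so neither the Weyl module `(2,0)⊕(0,2)`, nor the traceless `(1,1)`, nor the pseudoscalar `ε_{μνρσ}`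
  (`rank_four_eq_zero_of_pairwise_ne`: one reflection flips exactly one of four distinct indices) carries a `B₄`-invariant;
* `contraction_eq_trace_of_hyperoctahedral` — the operational form: contracting such a `K` against ANY bilinear `Φ_{μνρσ}` antisymmetric
  in its second pair (think `tr F_{μν}F_{ρσ}` at the bump) gives `2·K_{0101}·Σ_{μν} Φ_{μνμν}` — only the scalar `[tr F²]` channel survives.

Proofs: a single sign flip at an index of odd multiplicity forces `K = −K`; coordinate permutations (`Equiv.swap`) move the surviving
entries onto `K_{00}` / `K_{0101}`; antisymmetry fixes the relative sign.  Index form over `Fin 4` (the plaquette orientations of the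
tree's `plane (i, j)` fields are index pairs), no definitions.

Fleet lead `ym-spine-19353-p1` g21 (`--supports stmt-QuantumFields-27861`).  HONEST FRAMING: finite-dimensional linear algebra only; the
lattice OPE with a β- and volume-uniform remainder (the XL content of `ShellSign`), the sign `σ = −1` and the value of the Wilson
coefficient are NOT touched; no crux, NT statement, rung of record or mass gap is proved. [folklore]
-/

set_option autoImplicit false

namespace Summit.QuantumFields.YangMills.Theorems.ShellSignChannelSelection

/-! ## §1 Sign flips -/

/-- The single-axis sign flip at `m` is an admissible sign vector. [folklore] -/
theorem flip_admissible (m : Fin 4) : ∀ i : Fin 4, (if i = m then (-1 : ℝ) else 1) = 1 ∨ (if i = m then (-1 : ℝ) else 1) = -1 := by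
  intro i
  by_cases h : i = m
  · exact Or.inr (by rw [if_pos h])
  · exact Or.inl (by rw [if_neg h])

/-- **Rank 2: an off-diagonal entry of a sign-flip-invariant tensor vanishes.** [folklore] -/
theorem rank_two_offDiag_eq_zero (K : Fin 4 → Fin 4 → ℝ)
    (hsign : ∀ s : Fin 4 → ℝ, (∀ i, s i = 1 ∨ s i = -1) → ∀ μ ν, s μ * s ν * K μ ν = K μ ν)
    {μ ν : Fin 4} (hμν : μ ≠ ν) : K μ ν = 0 := by
  have h := hsign (fun i => if i = μ then (-1 : ℝ) else 1) (flip_admissible μ) μ ν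
  rw [if_pos rfl, if_neg (Ne.symm hμν)] at h
  linarith

/-- **Rank 2: a hyperoctahedrally invariant tensor is `K₀₀·δ`.**  No `B₄`-invariant vector in `Sym²₀(ℝ⁴)` other than through the trace.
[folklore] -/
theorem rank_two_eq_of_hyperoctahedral (K : Fin 4 → Fin 4 → ℝ)
    (hsign : ∀ s : Fin 4 → ℝ, (∀ i, s i = 1 ∨ s i = -1) → ∀ μ ν, s μ * s ν * K μ ν = K μ ν)
    (hperm : ∀ π : Equiv.Perm (Fin 4), ∀ μ ν, K (π μ) (π ν) = K μ ν) (μ ν : Fin 4) :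
    K μ ν = if μ = ν then K 0 0 else 0 := by
  by_cases hμν : μ = ν
  · subst hμν
    rw [if_pos rfl]
    have h := hperm (Equiv.swap 0 μ) 0 0
    rwa [Equiv.swap_apply_left] at h
  · rw [if_neg hμν]
    exact rank_two_offDiag_eq_zero K hsign hμν

/-- **The spin-2 channel dies**: a traceless hyperoctahedrally invariant rank-2 tensor vanishes. [folklore] -/
theorem rank_two_eq_zero_of_traceless (K : Fin 4 → Fin 4 → ℝ)
    (hsign : ∀ s : Fin 4 → ℝ, (∀ i, s i = 1 ∨ s i = -1) → ∀ μ ν, s μ * s ν * K μ ν = K μ ν)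
    (hperm : ∀ π : Equiv.Perm (Fin 4), ∀ μ ν, K (π μ) (π ν) = K μ ν) (htr : ∑ μ, K μ μ = 0) (μ ν : Fin 4) :
    K μ ν = 0 := by
  have hdiag : ∀ κ, K κ κ = K 0 0 := fun κ => by
    have := rank_two_eq_of_hyperoctahedral K hsign hperm κ κ; rwa [if_pos rfl] at this
  have h00 : K 0 0 = 0 := by
    simp only [hdiag, Finset.sum_const, Finset.card_univ, Fintype.card_fin, nsmul_eq_mul, Nat.cast_ofNat] at htr
    linarith
  rw [rank_two_eq_of_hyperoctahedral K hsign hperm μ ν]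
  split_ifs
  · exact h00
  · rfl

/-! ## §2 Rank 4, curvature type -/

/-- Transitivity of `S₄` on ordered pairs of distinct indices: some coordinate permutation maps `(0, 1)` to `(μ, ν)`. [folklore] -/
theorem exists_perm_zero_one (μ ν : Fin 4) (hμν : μ ≠ ν) : ∃ π : Equiv.Perm (Fin 4), π 0 = μ ∧ π 1 = ν := by
  revert μ ν
  decide

/-- **Rank 4: a single sign flip at an index of odd multiplicity kills the entry.** [folklore] -/
theorem rank_four_eq_zero_of_flip (K : Fin 4 → Fin 4 → Fin 4 → Fin 4 → ℝ)
    (hsign : ∀ s : Fin 4 → ℝ, (∀ i, s i = 1 ∨ s i = -1) →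
      ∀ μ ν ρ σ, s μ * s ν * s ρ * s σ * K μ ν ρ σ = K μ ν ρ σ)
    (m μ ν ρ σ : Fin 4)
    (hodd : (if μ = m then (-1 : ℝ) else 1) * (if ν = m then (-1 : ℝ) else 1) * (if ρ = m then (-1 : ℝ) else 1) *
      (if σ = m then (-1 : ℝ) else 1) = -1) :
    K μ ν ρ σ = 0 := by
  have h := hsign (fun i => if i = m then (-1 : ℝ) else 1) (flip_admissible m) μ ν ρ σ
  rw [hodd] at h
  linarith

/-- **Rank 4: a hyperoctahedrally invariant curvature-type tensor is `K₀₁₀₁·(δ_{μρ}δ_{νσ} − δ_{μσ}δ_{νρ})`** — the `B₄`-invariants of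
`Λ²ℝ⁴ ⊗ Λ²ℝ⁴` are spanned by the identity of `Λ²` (neither the Weyl module `(2,0)⊕(0,2)`, nor the traceless `(1,1)`, nor the
pseudoscalar `ε` survives). [folklore] -/
theorem rank_four_eq_of_hyperoctahedral (K : Fin 4 → Fin 4 → Fin 4 → Fin 4 → ℝ)
    (hanti₁ : ∀ μ ν ρ σ, K ν μ ρ σ = -K μ ν ρ σ) (hanti₂ : ∀ μ ν ρ σ, K μ ν σ ρ = -K μ ν ρ σ)
    (hsign : ∀ s : Fin 4 → ℝ, (∀ i, s i = 1 ∨ s i = -1) →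
      ∀ μ ν ρ σ, s μ * s ν * s ρ * s σ * K μ ν ρ σ = K μ ν ρ σ)
    (hperm : ∀ π : Equiv.Perm (Fin 4), ∀ μ ν ρ σ, K (π μ) (π ν) (π ρ) (π σ) = K μ ν ρ σ) (μ ν ρ σ : Fin 4) :
    K μ ν ρ σ = K 0 1 0 1 *
      ((if μ = ρ then 1 else 0) * (if ν = σ then 1 else 0) - (if μ = σ then 1 else 0) * (if ν = ρ then 1 else 0)) := by
  have kill := rank_four_eq_zero_of_flip K hsign
  -- diagonal pairs vanish by antisymmetry
  by_cases hμν : μ = ν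
  · subst hμν
    have h0 : K μ μ ρ σ = 0 := by have := hanti₁ μ μ ρ σ; linarith
    rw [h0]; ring
  by_cases hρσ : ρ = σ
  · subst hρσ
    have h0 : K μ ν ρ ρ = 0 := by have := hanti₂ μ ν ρ ρ; linarith
    rw [h0]; ring
  -- the surviving pattern `{μ, ν} = {ρ, σ}`
  by_cases hμρ : μ = ρ
  · subst hμρ
    by_cases hνσ : ν = σ
    · subst hνσ
      obtain ⟨π, hπ0, hπ1⟩ := exists_perm_zero_one μ ν hμν
      have h := hperm π 0 1 0 1
      rw [hπ0, hπ1] at h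
      rw [h, if_pos rfl, if_pos rfl, if_neg hμν, if_neg (Ne.symm hμν)]; ring
    · -- `ν` has odd multiplicity among `(μ, ν, μ, σ)`
      have h0 : K μ ν μ σ = 0 := kill ν μ ν μ σ (by
        rw [if_neg hμν, if_pos rfl, if_neg (Ne.symm hνσ)]; norm_num)
      rw [h0, if_neg hνσ, if_neg (Ne.symm hμν)]; ring
  by_cases hμσ : μ = σ
  · subst hμσ
    by_cases hνρ : ν = ρ
    · subst hνρ
      obtain ⟨π, hπ0, hπ1⟩ := exists_perm_zero_one μ ν hμν
      have h := hperm π 0 1 0 1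
      rw [hπ0, hπ1] at h
      rw [hanti₂ μ ν μ ν, h, if_neg hμν, if_neg (Ne.symm hμν), if_pos rfl, if_pos rfl]; ring
    · -- `ν` has odd multiplicity among `(μ, ν, ρ, μ)`
      have h0 : K μ ν ρ μ = 0 := kill ν μ ν ρ μ (by
        rw [if_neg hμν, if_pos rfl, if_neg (Ne.symm hνρ)]; norm_num)
      rw [h0, if_neg (Ne.symm hμν), if_neg hνρ]; ring
  -- `μ` has odd multiplicity among `(μ, ν, ρ, σ)`
  have h0 : K μ ν ρ σ = 0 := kill μ μ ν ρ σ (by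
    rw [if_pos rfl, if_neg (Ne.symm hμν), if_neg (Ne.symm hμρ), if_neg (Ne.symm hμσ)]; norm_num)
  rw [h0, if_neg hμρ, if_neg hμσ]; ring

/-- **The pseudoscalar channel dies by parity**: an entry with four pairwise distinct indices (the support of `ε_{μνρσ}`) of a
sign-flip-invariant rank-4 tensor vanishes — one reflection flips exactly one of the four indices. [folklore] -/
theorem rank_four_eq_zero_of_pairwise_ne (K : Fin 4 → Fin 4 → Fin 4 → Fin 4 → ℝ)
    (hsign : ∀ s : Fin 4 → ℝ, (∀ i, s i = 1 ∨ s i = -1) →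
      ∀ μ ν ρ σ, s μ * s ν * s ρ * s σ * K μ ν ρ σ = K μ ν ρ σ)
    {μ ν ρ σ : Fin 4} (hμν : μ ≠ ν) (hμρ : μ ≠ ρ) (hμσ : μ ≠ σ) : K μ ν ρ σ = 0 :=
  rank_four_eq_zero_of_flip K hsign μ μ ν ρ σ (by
    rw [if_pos rfl, if_neg (Ne.symm hμν), if_neg (Ne.symm hμρ), if_neg (Ne.symm hμσ)]; norm_num)

/-! ## §3 The operational form: only the scalar channel survives the contraction -/

/-- **Channel selection.**  For a hyperoctahedrally invariant curvature-type coefficient tensor `K` and ANY `Φ_{μνρσ}` antisymmetric in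
its second index pair (e.g. `Φ_{μνρσ} = tr F_{μν}F_{ρσ}` at the bump), the full contraction is `2·K₀₁₀₁·Σ_{μν} Φ_{μνμν}` — a multiple
of the scalar `tr F²` channel; the spin-2, Weyl and pseudoscalar channels contribute nothing. [folklore] -/
theorem contraction_eq_trace_of_hyperoctahedral (K Φ : Fin 4 → Fin 4 → Fin 4 → Fin 4 → ℝ)
    (hanti₁ : ∀ μ ν ρ σ, K ν μ ρ σ = -K μ ν ρ σ) (hanti₂ : ∀ μ ν ρ σ, K μ ν σ ρ = -K μ ν ρ σ)
    (hsign : ∀ s : Fin 4 → ℝ, (∀ i, s i = 1 ∨ s i = -1) →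
      ∀ μ ν ρ σ, s μ * s ν * s ρ * s σ * K μ ν ρ σ = K μ ν ρ σ)
    (hperm : ∀ π : Equiv.Perm (Fin 4), ∀ μ ν ρ σ, K (π μ) (π ν) (π ρ) (π σ) = K μ ν ρ σ)
    (hΦ : ∀ μ ν ρ σ, Φ μ ν σ ρ = -Φ μ ν ρ σ) :
    ∑ μ, ∑ ν, ∑ ρ, ∑ σ, K μ ν ρ σ * Φ μ ν ρ σ = 2 * K 0 1 0 1 * ∑ μ, ∑ ν, Φ μ ν μ ν := by
  have hK := rank_four_eq_of_hyperoctahedral K hanti₁ hanti₂ hsign hperm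
  -- the explicit form of `K`, entrywise inside the contraction
  have inner : ∀ μ ν, ∑ ρ, ∑ σ, K μ ν ρ σ * Φ μ ν ρ σ = 2 * K 0 1 0 1 * Φ μ ν μ ν := by
    intro μ ν
    have e : ∀ ρ σ, K μ ν ρ σ * Φ μ ν ρ σ =
        K 0 1 0 1 * ((if μ = ρ then (1 : ℝ) else 0) * (if ν = σ then 1 else 0) * Φ μ ν ρ σ) -
          K 0 1 0 1 * ((if μ = σ then (1 : ℝ) else 0) * (if ν = ρ then 1 else 0) * Φ μ ν ρ σ) := fun ρ σ => by
      rw [hK μ ν ρ σ]; ring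
    simp_rw [e, Finset.sum_sub_distrib, ← Finset.mul_sum]
    have s1 : ∑ ρ, ∑ σ, (if μ = ρ then (1 : ℝ) else 0) * (if ν = σ then 1 else 0) * Φ μ ν ρ σ = Φ μ ν μ ν := by
      rw [Finset.sum_eq_single_of_mem μ (Finset.mem_univ _) fun ρ _ hρ => Finset.sum_eq_zero fun σ _ => by
        rw [if_neg (Ne.symm hρ)]; ring]
      rw [Finset.sum_eq_single_of_mem ν (Finset.mem_univ _) fun σ _ hσ => by rw [if_neg (Ne.symm hσ)]; ring]
      rw [if_pos rfl, if_pos rfl]; ring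
    have s2 : ∑ ρ, ∑ σ, (if μ = σ then (1 : ℝ) else 0) * (if ν = ρ then 1 else 0) * Φ μ ν ρ σ = Φ μ ν ν μ := by
      rw [Finset.sum_eq_single_of_mem ν (Finset.mem_univ _) fun ρ _ hρ => Finset.sum_eq_zero fun σ _ => by
        rw [if_neg (Ne.symm hρ)]; ring]
      rw [Finset.sum_eq_single_of_mem μ (Finset.mem_univ _) fun σ _ hσ => by rw [if_neg (Ne.symm hσ)]; ring]
      rw [if_pos rfl, if_pos rfl]; ring
    rw [s1, s2, hΦ μ ν μ ν]
    ring
  simp_rw [inner]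
  rw [Finset.mul_sum]
  refine Finset.sum_congr rfl fun μ _ => ?_
  rw [Finset.mul_sum]

end Summit.QuantumFields.YangMills.Theorems.ShellSignChannelSelection
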